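import Summits.Ventures.HSemireg.WedgeHankelRecurrenceGaussZerosLidskii

/-!
# Venture HSemireg — **STIELTJES' ELECTROSTATIC IDENTITY FOR THE HERMITE ZEROS**: for `f = ∏_j (X − z_j)` with distinct `z_j`, `f''(z_k) = 2 f'(z_k) Σ_{j ≠ k} 1∕(z_k − z_j)`; Mathlib's Hermite
# polynomials satisfy `He_n'' = X He_n' − n He_n`; hence at the zeros `x_0 < ⋯ < x_t` of `He_{t+1}` (N359) **`Σ_{j ≠ k} 1∕(x_k − x_j) = x_k ∕ 2`** — the equilibrium condition of `t + 1` unit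
# charges on the line with logarithmic repulsion in the external field `x²∕4` (Stieltjes 1885)

HONEST FRAMING. Part of the Lean index of the computation cell `pub-hsemireg` (seat p10 gen 46, Sunday typer «UNIFORM-IN-n»).  Real polynomials, derivatives and finite sums only; no variety, no
cohomology theory, no sheaf, no Ext group and no semiregularity map is constructed here; nothing here says that HC / HC_CM / HC_AV holds; no Literature fact (unproved `Prop`) is declared or used.
Custodian versions as in `WedgeHankelSiegelIdeal` (1/3).
SOURCES (cited).  T. J. Stieltjes, *Sur certains polynômes qui vérifient une équation différentielle linéaire du second ordre et sur la théorie des fonctions de Lamé*, Acta Math. 6 (1885) 321–326,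
and *Sur les polynômes de Jacobi*, C. R. Acad. Sci. 100 (1885) 620–622; G. Szegő, *Orthogonal Polynomials*, §6.7 (Thm 6.7.2, the Hermite case (6.7.9)–(6.7.10)), (5.5.2) (the Hermite equation);
M. E. H. Ismail, *Classical and Quantum Orthogonal Polynomials* (2005), §3.5; F. Marcellán, A. Martínez-Finkelshtein, P. Martínez-González, *Electrostatic models for zeros of polynomials*,
J. Comput. Appl. Math. 207 (2007) 258–272.
PROOF TYPED HERE.  `f'' = Σ_i Σ_{j ≠ i} ∏_{l ≠ i, j} (X − z_l)` (N334 `derivative_two_prod_X_sub_C_eq_sum`); at `z_k` only the pairs containing `k` survive, each twice; `∏_{l ≠ k} (z_k − z_l) =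
(z_k − z_j) ∏_{l ≠ k, j} (z_k − z_l)`; the Hermite equation from Mathlib `hermite_succ` (`He_{n+1} = X He_n − He_n'`) and N359 `hermite_derivative_succ` (`He_{n+1}' = (n+1) He_n`).
DEDUP DISCLOSURE (`rg -n -i 'electrostatic|sum_inv_sub|hermite_ode' Summits/Ventures/HSemireg`, 2026-09-03): N350 `eval_derivative_prod_eq_mul_sum_inv` (`f'(ξ) = f(ξ) Σ 1∕(ξ − z_i)` off the
zeros), N334 (`f''` as a double sum, Laguerre's inequality); the second-derivative-at-a-node formula, the Hermite equation and Stieltjes' identity are new.  The 4 names below: 0 hits tree-wide.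

WHAT IS IN THE TREE.  N334 `derivative_two_prod_X_sub_C_eq_sum`; N284 `eval_derivative_prod_X_sub_C_at_node`; N359 `hermite_derivative_succ`, `hermite_zeros`; Mathlib `Polynomial.hermite_succ`.
THIS FILE (namespace `Summit.Ventures.HSemireg.Wedge.HankelOuter` continued; CHAINED on N387 (import only); 0 definitions):
* §1153 **`eval_derivative_two_prod_at_node`** (`f''(z_k) = 2 Σ_{j≠k} ∏_{l≠k,j} (z_k − z_l)`), **`sum_inv_sub_nodes_eq`** (`2 f'(z_k) Σ_{j≠k} (z_k − z_j)⁻¹ = f''(z_k)`), **`hermite_second_derivative`**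
  (`He_n'' = X He_n' − n He_n`), **`hermite_zeros_electrostatic`** (`Σ_{j≠k} (x_k − x_j)⁻¹ = x_k∕2`).
CAVEATS.  Hermite only (the Laguerre ∕ Jacobi equilibria need their differential equations, not typed in this lineage).  Nothing Ext-side.  New names only.
-/

open Module Polynomial
open scoped Matrix Polynomial

namespace Summit.Ventures.HSemireg.Wedge.HankelOuter

/-! ## §1153. Stieltjes' electrostatics for Hermite zeros -/

/-- **`f''(z_k) = 2 Σ_{j ≠ k} ∏_{l ≠ k, j} (z_k − z_l)`** for `f = ∏_j (X − z_j)`. [this file, §1153] -/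
theorem eval_derivative_two_prod_at_node {n : ℕ} (z : Fin n → ℝ) (k : Fin n) :
    (derivative (derivative (∏ i, (Polynomial.X - C (z i))))).eval (z k) = 2 * ∑ j ∈ Finset.univ.erase k, ∏ l ∈ (Finset.univ.erase k).erase j, (z k - z l) := by
  classical
  rw [derivative_two_prod_X_sub_C_eq_sum, eval_finsetSum]
  -- the term `T(i, j) = ∏_{l ≠ i, j} (z_k − z_l)`
  have hT : ∀ i j : Fin n, (∏ l ∈ (Finset.univ.erase i).erase j, (Polynomial.X - C (z l))).eval (z k) = ∏ l ∈ (Finset.univ.erase i).erase j, (z k - z l) := fun i j => by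
    rw [eval_prod]; exact Finset.prod_congr rfl fun l _ => by rw [eval_sub, eval_X, eval_C]
  have hev : ∀ i : Fin n, (∑ j ∈ Finset.univ.erase i, ∏ l ∈ (Finset.univ.erase i).erase j, (Polynomial.X - C (z l))).eval (z k) =
      ∑ j ∈ Finset.univ.erase i, ∏ l ∈ (Finset.univ.erase i).erase j, (z k - z l) := fun i => by
    rw [eval_finsetSum]; exact Finset.sum_congr rfl fun j _ => hT i j
  simp_rw [hev]
  -- terms with `k ∉ {i, j}` vanish
  have hvan : ∀ i j : Fin n, i ≠ k → j ≠ k → ∏ l ∈ (Finset.univ.erase i).erase j, (z k - z l) = 0 := fun i j hi hj =>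
    Finset.prod_eq_zero (Finset.mem_erase.2 ⟨Ne.symm hj, Finset.mem_erase.2 ⟨Ne.symm hi, Finset.mem_univ k⟩⟩) (sub_self _)
  -- symmetry of the index set
  have hsymm : ∀ i : Fin n, (Finset.univ.erase i).erase k = (Finset.univ.erase k).erase i := fun i => by
    ext l; simp only [Finset.mem_erase, Finset.mem_univ, and_true]; tauto
  rw [← Finset.add_sum_erase Finset.univ _ (Finset.mem_univ k), two_mul]
  congr 1
  refine Finset.sum_congr rfl fun i hi => ?_
  have hik : i ≠ k := (Finset.mem_erase.1 hi).1
  rw [← Finset.add_sum_erase (Finset.univ.erase i) _ (Finset.mem_erase.2 ⟨Ne.symm hik, Finset.mem_univ k⟩)]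
  rw [Finset.sum_eq_zero fun j hj => hvan i j hik (Finset.mem_erase.1 hj).1, add_zero, hsymm i]

/-- **`2 f'(z_k) · Σ_{j ≠ k} (z_k − z_j)⁻¹ = f''(z_k)`** for distinct nodes. [Szegő §6.7; this file, §1153] -/
theorem sum_inv_sub_nodes_eq {n : ℕ} {z : Fin n → ℝ} (hz : Function.Injective z) (k : Fin n) :
    2 * (derivative (∏ i, (Polynomial.X - C (z i)))).eval (z k) * ∑ j ∈ Finset.univ.erase k, (z k - z j)⁻¹ =
      (derivative (derivative (∏ i, (Polynomial.X - C (z i))))).eval (z k) := by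
  rw [eval_derivative_two_prod_at_node, eval_derivative_prod_X_sub_C_at_node, mul_assoc, Finset.mul_sum]
  congr 1
  refine Finset.sum_congr rfl fun j hj => ?_
  have hne : z k - z j ≠ 0 := sub_ne_zero.2 fun h => (Finset.mem_erase.1 hj).1 (hz h).symm
  rw [← Finset.mul_prod_erase _ _ hj, mul_comm (z k - z j), mul_assoc, mul_inv_cancel₀ hne, mul_one]

/-- **THE HERMITE EQUATION: `He_n'' = X · He_n' − n · He_n`** for Mathlib's probabilists' Hermite polynomials (over `ℤ`). [Szegő (5.5.2); Abramowitz–Stegun 22.6.21; this file, §1153] -/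
theorem hermite_second_derivative (n : ℕ) :
    derivative (derivative (Polynomial.hermite n)) = Polynomial.X * derivative (Polynomial.hermite n) - C (n : ℤ) * Polynomial.hermite n := by
  rcases n with _ | m
  · simp [Polynomial.hermite_zero]
  · rw [hermite_derivative_succ, derivative_mul, derivative_C, zero_mul, zero_add]
    have h := Polynomial.hermite_succ m
    -- `He_m' = X He_m − He_{m+1}`
    have hd : derivative (Polynomial.hermite m) = Polynomial.X * Polynomial.hermite m - Polynomial.hermite (m + 1) := by rw [h]; ring
    rw [hd]
    push_cast
    ring

/-- **STIELTJES (1885): the zeros `x_0 < ⋯ < x_t` of `He_{t+1}` satisfy `Σ_{j ≠ k} 1∕(x_k − x_j) = x_k∕2` for every `k`.** [Stieltjes 1885; Szegő Thm 6.7.2; this file, §1153] -/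
theorem hermite_zeros_electrostatic {t : ℕ} {x : Fin (t + 1) → ℝ} (hx : StrictMono x)
    (hxq : (Polynomial.hermite (t + 1)).map (Int.castRingHom ℝ) = ∏ k, (Polynomial.X - C (x k))) (k : Fin (t + 1)) :
    ∑ j ∈ Finset.univ.erase k, (x k - x j)⁻¹ = x k / 2 := by
  have hinj := hx.injective
  -- the Hermite equation over `ℝ`, evaluated at the zero `x_k`
  have hode := congrArg (Polynomial.map (Int.castRingHom ℝ)) (hermite_second_derivative (t + 1))
  rw [Polynomial.map_sub, Polynomial.map_mul, Polynomial.map_mul, Polynomial.map_X, Polynomial.map_C, ← Polynomial.derivative_map, ← Polynomial.derivative_map, hxq] at hode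
  have hroot : (∏ j, (Polynomial.X - C (x j))).eval (x k) = 0 := by rw [eval_prod]; exact Finset.prod_eq_zero (Finset.mem_univ k) (by simp)
  have hev := congrArg (eval (x k)) hode
  rw [eval_sub, eval_mul, eval_mul, eval_X, eval_C, hroot, mul_zero, sub_zero, ← sum_inv_sub_nodes_eq hinj k] at hev
  -- cancel `f'(x_k) ≠ 0`
  have hder : (derivative (∏ i, (Polynomial.X - C (x i)))).eval (x k) ≠ 0 := by
    rw [eval_derivative_prod_X_sub_C_at_node]
    exact Finset.prod_ne_zero_iff.2 fun j hj => sub_ne_zero.2 fun h => (Finset.mem_erase.1 hj).1 (hinj h).symm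
  have h2 : 2 * ∑ j ∈ Finset.univ.erase k, (x k - x j)⁻¹ = x k := by
    apply mul_left_cancel₀ hder
    linarith [hev]
  linarith

end Summit.Ventures.HSemireg.Wedge.HankelOuter
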